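import Mathlib
import Summits.KontsevichZagierPeriods.KontsevichZagierPeriods.Theorems.SoloInformedBandLemma
import HarnessLib
import HarnessLib.Audit

/-!
# SoloInformed — divergence across an adjacent band (PRES-RAT(2), Phase IV-3)

Solo programme `solo-KontsevichZagierPeriods-informed`, session s110.  The measure-theoretic
half of the NON-INTEGRABILITY LEMMA of the PRES-RAT(2) reduction ("a denominator arc cannot
bound the domain"): for a differentiable function `a` on an open interval `(u, v)` and `η > 0`,
the function `(x, y) ↦ 1 / (y − a(x))` is NOT integrable on the adjacent band
`{(x, y) | u < x < v, a(x) < y < a(x) + η}`.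

Proof: the shear `(x, t) ↦ (x, a(x) + t η)` (the band straightening `soloInformedBandMap a (a + η)`
of the BAND LEMMA file) maps the rectangle `(u, v) × (0, 1)` onto the band with Jacobian `η`, so by
the change-of-variables criterion integrability on the band is integrability of `(x, t) ↦ 1 / t`
on the rectangle; transporting along `MeasurableEquiv.finTwoArrow` to `ℝ × ℝ` and taking a.e.
sections (Fubini) this would make `t ↦ 1 / t` integrable on `(0, 1)`, which it is not
(`integrableOn_Ioo_rpow_iff`; kept as a local step — the one-variable fact is in the tree).  A comparison corollary packages the form used downstream: no
function `f` with `c ≤ |f (x, y)| · (y − a(x))` on the band (`c > 0`) is integrable on a set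
containing the band.

References: folklore (Fubini–Tonelli); used in the PRES-RAT(2) design memo, §0 (NONINT).
-/

noncomputable section

open scoped BigOperators Topology ENNReal
open MeasureTheory Set Filter Metric

namespace Summit.KontsevichZagierPeriods.KontsevichZagierPeriods.Theorems

/-! ### The rectangle `(u, v) × (0, 1)` and Fubini -/

/-- The open rectangle `(u, v) × (0, 1)` in `ℝ²`. [this work] -/
def soloInformedRect (u v : ℝ) : Set (Fin 2 → ℝ) :=
  {x | (u < x 0 ∧ x 0 < v) ∧ (0 < x 1 ∧ x 1 < 1)}

/-- The rectangle as an intersection of coordinate preimages. -/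
theorem soloInformedRect_eq (u v : ℝ) :
    soloInformedRect u v =
      (fun x : Fin 2 → ℝ => x 0) ⁻¹' Ioo u v ∩ (fun x : Fin 2 → ℝ => x 1) ⁻¹' Ioo 0 1 := by
  ext x
  simp [soloInformedRect, mem_Ioo]

/-- The rectangle is open. -/
theorem soloInformed_isOpen_rect (u v : ℝ) : IsOpen (soloInformedRect u v) := by
  rw [soloInformedRect_eq]
  exact (isOpen_Ioo.preimage (continuous_apply 0)).inter
    (isOpen_Ioo.preimage (continuous_apply 1))

/-- **Fubini step.** `(x, t) ↦ t⁻¹` is not integrable on the rectangle `(u, v) × (0, 1)`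
(`u < v`): almost every `x`-section would be integrable on `(0, 1)`. -/
theorem soloInformed_not_integrableOn_inv_snd {u v : ℝ} (huv : u < v) :
    ¬ IntegrableOn (fun x : Fin 2 → ℝ => (x 1)⁻¹) (soloInformedRect u v) := by
  intro h
  set e : (Fin 2 → ℝ) ≃ᵐ ℝ × ℝ := MeasurableEquiv.finTwoArrow with he_def
  have he : MeasurePreserving e volume volume := volume_preserving_finTwoArrow ℝ
  have hpre : e ⁻¹' (Ioo u v ×ˢ Ioo (0 : ℝ) 1) = soloInformedRect u v := by
    ext x
    simp [he_def, soloInformedRect, Set.mem_prod, mem_Ioo]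
  have hcomp : ((fun p : ℝ × ℝ => p.2⁻¹) ∘ e) = fun x : Fin 2 → ℝ => (x 1)⁻¹ := by
    funext x
    simp [he_def]
  have h2 : IntegrableOn (fun p : ℝ × ℝ => p.2⁻¹) (Ioo u v ×ˢ Ioo (0 : ℝ) 1) volume := by
    rw [← he.integrableOn_comp_preimage e.measurableEmbedding, hcomp, hpre]
    exact h
  rw [IntegrableOn, Measure.volume_eq_prod, ← Measure.prod_restrict] at h2
  have hae := h2.prod_right_ae
  -- `t ↦ t⁻¹` is not integrable on `(0, 1)` (`integrableOn_Ioo_rpow_iff` with exponent `-1`)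
  have h1D : ¬ IntegrableOn (fun t : ℝ => t⁻¹) (Ioo (0 : ℝ) 1) := by
    intro h1
    have h1' : IntegrableOn (fun t : ℝ => t ^ (-1 : ℝ)) (Ioo (0 : ℝ) 1) := by
      refine h1.congr_fun (fun t _ => ?_) measurableSet_Ioo
      exact (Real.rpow_neg_one t).symm
    have := (intervalIntegral.integrableOn_Ioo_rpow_iff (s := -1) one_pos).1 h1'
    norm_num at this
  have hfalse : ∀ᵐ x ∂(volume.restrict (Ioo u v) : Measure ℝ), False := by
    filter_upwards [hae] with x hx
    exact h1D hx
  rw [eventually_false_iff_eq_bot, ae_eq_bot, Measure.restrict_eq_zero, Real.volume_Ioo] at hfalse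
  have hpos : (0 : ℝ≥0∞) < ENNReal.ofReal (v - u) := by
    rw [ENNReal.ofReal_pos]
    linarith
  exact hpos.ne' hfalse

/-! ### The shear onto the adjacent band -/

/-- The band of height `η` adjacent (from above) to the graph of `a` over `(u, v)`:
`{(x, y) | u < x < v, a(x) < y < a(x) + η}`. [this work] -/
def soloInformedAdjBand (a : ℝ → ℝ) (u v η : ℝ) : Set (Fin 2 → ℝ) :=
  {y | (u < y 0 ∧ y 0 < v) ∧ a (y 0) < y 1 ∧ y 1 < a (y 0) + η}

/-- **The straightening maps the rectangle onto the band between `a` and `b`.** -/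
theorem soloInformed_bandMap_image_rect {a b : ℝ → ℝ} {u v : ℝ}
    (hlt : ∀ s : ℝ, u < s → s < v → a s < b s) :
    soloInformedBandMap a b '' soloInformedRect u v =
      {y | (u < y 0 ∧ y 0 < v) ∧ a (y 0) < y 1 ∧ y 1 < b (y 0)} := by
  ext y
  constructor
  · rintro ⟨x, hx, rfl⟩
    have h0 := hx.1
    have h1 := hx.2
    have hba : 0 < b (x 0) - a (x 0) := sub_pos.2 (hlt _ h0.1 h0.2)
    refine ⟨h0, ?_, ?_⟩
    · simp only [soloInformedBandMap_apply_zero, soloInformedBandMap_apply_one]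
      nlinarith [h1.1]
    · simp only [soloInformedBandMap_apply_zero, soloInformedBandMap_apply_one]
      nlinarith [h1.2]
  · rintro ⟨h0, ha, hb⟩
    have hba : 0 < b (y 0) - a (y 0) := by linarith
    refine ⟨![y 0, (y 1 - a (y 0)) / (b (y 0) - a (y 0))], ⟨?_, ?_⟩, ?_⟩
    · simpa using h0
    · refine ⟨?_, ?_⟩
      · simp only [Fin.isValue, Matrix.cons_val_one, Matrix.cons_val_fin_one]
        exact div_pos (by linarith) hba
      · simp only [Fin.isValue, Matrix.cons_val_one, Matrix.cons_val_fin_one]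
        rw [div_lt_one hba]
        linarith
    · funext i
      fin_cases i
      · simp [soloInformedBandMap]
      · simp only [soloInformedBandMap, Fin.mk_one, Fin.isValue, Matrix.cons_val_one,
          Matrix.cons_val_fin_one, Matrix.cons_val_zero]
        field_simp
        ring

/-- The adjacent band is the image of the rectangle under the shear `(x, t) ↦ (x, a(x) + t η)`. -/
theorem soloInformed_shear_image {a : ℝ → ℝ} {u v η : ℝ} (hη : 0 < η) :
    soloInformedBandMap a (fun s => a s + η) '' soloInformedRect u v = soloInformedAdjBand a u v η := by
  rw [soloInformed_bandMap_image_rect (fun s _ _ => by linarith)]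
  rfl

/-- The adjacent band is open when `a` is continuous on `(u, v)`. -/
theorem soloInformed_isOpen_adjBand {a : ℝ → ℝ} {u v η : ℝ} (ha : ContinuousOn a (Ioo u v)) :
    IsOpen (soloInformedAdjBand a u v η) := by
  have hU : IsOpen {y : Fin 2 → ℝ | u < y 0 ∧ y 0 < v} :=
    isOpen_Ioo.preimage (continuous_apply 0)
  have hc : ContinuousOn (fun y : Fin 2 → ℝ => y 1 - a (y 0)) {y : Fin 2 → ℝ | u < y 0 ∧ y 0 < v} := by
    refine ((continuous_apply 1).continuousOn).sub ?_
    exact ha.comp (continuous_apply 0).continuousOn fun y hy => hy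
  have h := hc.isOpen_inter_preimage hU (isOpen_Ioo (a := 0) (b := η))
  convert h using 1
  ext y
  simp only [soloInformedAdjBand, mem_setOf_eq, mem_inter_iff, mem_preimage, mem_Ioo]
  constructor
  · rintro ⟨h0, h1, h2⟩
    exact ⟨h0, by linarith, by linarith⟩
  · rintro ⟨h0, h1, h2⟩
    exact ⟨h0, by linarith, by linarith⟩

/-- **SHEAR DIVERGENCE.**  For `a` differentiable on `(u, v)` (`u < v`) and `η > 0`, the function
`(x, y) ↦ (y − a(x))⁻¹` is not integrable on the adjacent band
`{u < x < v, a(x) < y < a(x) + η}`. -/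
theorem soloInformed_not_integrableOn_shear {a a' : ℝ → ℝ} {u v η : ℝ} (huv : u < v)
    (hη : 0 < η) (ha : ∀ s : ℝ, u < s → s < v → HasDerivAt a (a' s) s) :
    ¬ IntegrableOn (fun y : Fin 2 → ℝ => (y 1 - a (y 0))⁻¹) (soloInformedAdjBand a u v η) := by
  intro h
  set b : ℝ → ℝ := fun s => a s + η with hb_def
  have hlt : ∀ x ∈ soloInformedRect u v, a (x 0) < b (x 0) := fun x _ => by
    simp only [hb_def]
    linarith
  have hderiv : ∀ x ∈ soloInformedRect u v,
      HasFDerivWithinAt (soloInformedBandMap a b) (soloInformedBandDeriv a b a' a' x)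
        (soloInformedRect u v) x := fun x hx =>
    (soloInformed_hasFDerivAt_bandMap (ha _ hx.1.1 hx.1.2)
      ((ha _ hx.1.1 hx.1.2).add_const η)).hasFDerivWithinAt
  have hinj : InjOn (soloInformedBandMap a b) (soloInformedRect u v) :=
    soloInformed_injOn_bandMap hlt
  have hmeas : MeasurableSet (soloInformedRect u v) := (soloInformed_isOpen_rect u v).measurableSet
  rw [← soloInformed_shear_image hη,
    integrableOn_image_iff_integrableOn_abs_det_fderiv_smul volume hmeas hderiv hinj] at h
  have h' : IntegrableOn (fun x : Fin 2 → ℝ => (x 1)⁻¹) (soloInformedRect u v) := by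
    refine h.congr_fun (fun x hx => ?_) hmeas
    have hx1 : x 1 ≠ 0 := hx.2.1.ne'
    have hba : b (x 0) - a (x 0) = η := by simp [hb_def]
    dsimp only
    rw [soloInformed_det_bandDeriv, hba, abs_of_pos hη, smul_eq_mul,
      soloInformedBandMap_apply_zero, soloInformedBandMap_apply_one, hba]
    field_simp
    ring
  exact soloInformed_not_integrableOn_inv_snd huv h'

/-- **Comparison form.**  If `c > 0`, `f` satisfies `c ≤ |f (x, y)| · (y − a(x))` on the adjacent
band and the band lies in `Ω`, then `f` is not integrable on `Ω`. -/
theorem soloInformed_not_integrableOn_of_shear_bound {a a' : ℝ → ℝ} {u v η c : ℝ}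
    {f : (Fin 2 → ℝ) → ℝ} {Ω : Set (Fin 2 → ℝ)} (huv : u < v) (hη : 0 < η) (hc : 0 < c)
    (ha : ∀ s : ℝ, u < s → s < v → HasDerivAt a (a' s) s)
    (hΩ : soloInformedAdjBand a u v η ⊆ Ω)
    (hbound : ∀ y ∈ soloInformedAdjBand a u v η, c ≤ |f y| * (y 1 - a (y 0)))
    (hf : IntegrableOn f Ω) : False := by
  have hcont : ContinuousOn a (Ioo u v) := fun s hs =>
    (ha s hs.1 hs.2).continuousAt.continuousWithinAt
  have hopen := soloInformed_isOpen_adjBand (η := η) hcont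
  have hfB : IntegrableOn f (soloInformedAdjBand a u v η) := hf.mono_set hΩ
  have hg : ContinuousOn (fun y : Fin 2 → ℝ => (y 1 - a (y 0))⁻¹) (soloInformedAdjBand a u v η) := by
    refine ContinuousOn.inv₀ ?_ fun y hy => by linarith [hy.2.1]
    refine ((continuous_apply 1).continuousOn).sub ?_
    exact hcont.comp (continuous_apply 0).continuousOn fun y hy => hy.1
  refine soloInformed_not_integrableOn_shear huv hη ha ?_
  refine Integrable.mono (hfB.smul (c⁻¹)) (hg.aestronglyMeasurable hopen.measurableSet) ?_
  refine (ae_restrict_iff' hopen.measurableSet).2 (Eventually.of_forall fun y hy => ?_)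
  have hd : 0 < y 1 - a (y 0) := by linarith [hy.2.1]
  have hb := hbound y hy
  rw [Real.norm_eq_abs, abs_of_pos (inv_pos.2 hd), Pi.smul_apply, smul_eq_mul, norm_mul,
    Real.norm_eq_abs, Real.norm_eq_abs, abs_of_pos (inv_pos.2 hc)]
  rw [inv_le_iff_one_le_mul₀ hd]
  have : 1 ≤ c⁻¹ * (|f y| * (y 1 - a (y 0))) := by
    rw [le_inv_mul_iff₀ hc]
    simpa using hb
  calc (1 : ℝ) ≤ c⁻¹ * (|f y| * (y 1 - a (y 0))) := this
    _ = c⁻¹ * |f y| * (y 1 - a (y 0)) := by ring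

end Summit.KontsevichZagierPeriods.KontsevichZagierPeriods.Theorems

end
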